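import Literature.Algebra.Homology.ContCohomologyPullbackCoboundary
import HarnessLib

/-!
# The inhomogeneous `2`-cocycle of a homogeneous `2`-cocycle; classes vanish iff it is a coboundary

Companion of `ContCohomologyTransgressionKernel.lean` / `ContCohomologyPullbackCoboundary.lean` (Mathlib's
`continuousCohomology` = homology of the HOMOGENEOUS continuous cochains `C(G, C(G, C(G, Λ)))^G` in
`TopModuleCat`, trivial coefficients `Λ`).  This proof-only file (no definitions) is the dictionary
between degree-`2` classes and INHOMOGENEOUS continuous `2`-cocycles `c : G × G → Λ`,
`c(g,h) + c(gh,l) = c(g,hl) + c(h,l)` [cite: SerreGaloisCohomology1997, I §2.3] ("`H²(G, A)` est le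
groupe des classes de systèmes de facteurs continus"):

* `d_iCycles_two` — the cochain `F` of a `2`-cocycle is `d²`-closed;
* `twoCocycle_inhomogeneous` — `c(g,h) := F(1, g, gh)` satisfies the inhomogeneous cocycle identity;
  `continuous_twoCochain_inhomogeneous` — it is jointly continuous when `G` is locally compact;
* `π_two_eq_zero_of_exists_oneCochain` / `exists_oneCochain_of_π_two_eq_zero` — `[z] = 0` iff
  `F(1, g, gh) = b(g) + b(h) − b(gh)` for a continuous `b : G → Λ`;
* `π_two_eq_zero_of_forall_inhomogeneous` — **criterion for `H²(G, Λ) = 0`** (`G` locally compact): it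
  suffices that every jointly continuous NORMALIZED inhomogeneous `2`-cocycle is the coboundary
  `β(gh) − β(g) − β(h)` of a continuous `β`.

Generic; no anabelian content.  (Used by `AnabelianGeometry/AbsoluteAnabelian/FreeProfiniteContinuousH2.lean`:
`H²_cont` of a free profinite group of finite rank vanishes.)
-/

noncomputable section

open CategoryTheory CategoryTheory.Limits TopRep ContRepresentation Topology

namespace ContinuousCohomology

universe v

section Inhomogeneous

variable {G : Type v} [Group G] [TopologicalSpace G] [IsTopologicalGroup G]
  {Λ : Type v} [AddCommGroup Λ] [TopologicalSpace Λ] [IsTopologicalAddGroup Λ]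

/-- The cochain underlying a `2`-cocycle is `d²`-closed. [cite: SerreGaloisCohomology1997, I §2.3] -/
theorem d_iCycles_two (z : (homogeneousCochains (trivCoeff G Λ)).cycles 2) :
    ((homogeneousCochains (trivCoeff G Λ)).d 2 3).hom
      (((homogeneousCochains (trivCoeff G Λ)).iCycles 2).hom z) = 0 := by
  have h := congrArg (fun ψ => ψ.hom z) ((homogeneousCochains (trivCoeff G Λ)).iCycles_d 2 3)
  simpa using h

/-- **The inhomogeneous cocycle identity.**  For a `2`-cocycle `F` of the trivial module, the function
`c(g, h) := F(1, g, gh)` satisfies `c(g, h) + c(gh, l) = c(g, hl) + c(h, l)` (the `2`-cocycle identity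
for the trivial action; `d² F = 0` evaluated at `(1, g, gh, ghl)` together with the invariance
`F(g, gh, ghl) = F(1, h, hl)`). [cite: SerreGaloisCohomology1997, I §2.3] -/
theorem twoCocycle_inhomogeneous (F : (homogeneousCochains (trivCoeff G Λ)).X 2)
    (hF : ((homogeneousCochains (trivCoeff G Λ)).d 2 3).hom F = 0) (g h l : G) :
    F.1 1 g (g * h) + F.1 1 (g * h) (g * h * l) = F.1 1 g (g * (h * l)) + F.1 1 h (h * l) := by
  have hd := congrArg (fun c : (homogeneousCochains (trivCoeff G Λ)).X 3 => c.1 1 g (g * h) (g * h * l)) hF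
  change (((homogeneousCochains (trivCoeff G Λ)).d 2 3).hom F).1 1 g (g * h) (g * h * l) = 0 at hd
  rw [d_twoCochain_apply] at hd
  have hinv : F.1 g (g * h) (g * h * l) = F.1 1 h (h * l) := by
    rw [twoCochain_apply_eq (Λ := Λ) F g (g * h) (g * h * l), mul_assoc, inv_mul_cancel_left,
      inv_mul_cancel_left]
  rw [hinv] at hd
  -- `F(1,h,hl) - (F(1,gh,ghl) - (F(1,g,ghl) - F(1,g,gh))) = 0`
  rw [← mul_assoc]
  have : F.1 1 g (g * h) + F.1 1 (g * h) (g * h * l) - (F.1 1 g (g * h * l) + F.1 1 h (h * l)) = 0 := by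
    rw [← neg_eq_zero, ← hd]
    abel
  exact sub_eq_zero.mp this

/-- For a `2`-cocycle `F` of the trivial module, `(g, h) ↦ F(1, g, gh)` is JOINTLY continuous when `G` is
locally compact (evaluation `C(G, Λ) × G → Λ` is then continuous). [cite: SerreGaloisCohomology1997, I §2.3] -/
theorem continuous_twoCochain_inhomogeneous [LocallyCompactSpace G]
    (F : (homogeneousCochains (trivCoeff G Λ)).X 2) :
    Continuous fun p : G × G => F.1 1 p.1 (p.1 * p.2) := by
  have h1 : Continuous fun p : G × G => F.1 1 p.1 := (F.1 1).continuous.comp continuous_fst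
  exact h1.eval (continuous_fst.mul continuous_snd)

/-- **A `2`-cocycle whose inhomogeneous cocycle is an inhomogeneous coboundary has class `0`.**  If
`F(1, g, gh) = b(g) + b(h) − b(gh)` for a continuous `b : G → Λ` (`F` the cochain of the `2`-cocycle `z`),
then `[z] = 0` in `H²(G, Λ)`: `F = d¹σ` for the invariant `1`-cochain `σ(x, y) = b(x⁻¹y)`.
[cite: SerreGaloisCohomology1997, I §2.3] -/
theorem π_two_eq_zero_of_exists_oneCochain (z : (homogeneousCochains (trivCoeff G Λ)).cycles 2)
    (b : C(G, Λ))
    (hb : ∀ g h, (((homogeneousCochains (trivCoeff G Λ)).iCycles 2).hom z).1 1 g (g * h) =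
      b g + b h - b (g * h)) :
    ((homogeneousCochains (trivCoeff G Λ)).homologyπ 2).hom z = 0 := by
  -- the bounding invariant `1`-cochain `σ(x, y) = b(x⁻¹ y)`
  let Fb : C(G × G, Λ) :=
    ⟨fun p => b (p.1⁻¹ * p.2), b.continuous.comp (continuous_fst.inv.mul continuous_snd)⟩
  let σ : (homogeneousCochains (trivCoeff G Λ)).X 1 :=
    ⟨Fb.curry, fun g => by
      refine ContinuousMap.ext fun x => ContinuousMap.ext fun y => ?_
      change b ((g⁻¹ * x)⁻¹ * (g⁻¹ * y)) = b (x⁻¹ * y)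
      rw [mul_inv_rev, inv_inv, mul_assoc, mul_inv_cancel_left]⟩
  have hd : ((homogeneousCochains (trivCoeff G Λ)).d 1 2).hom σ =
      ((homogeneousCochains (trivCoeff G Λ)).iCycles 2).hom z := by
    apply Subtype.ext
    ext x y w
    rw [d_oneCochain_apply, twoCochain_apply_eq (Λ := Λ) _ x y w]
    change b (y⁻¹ * w) - (b (x⁻¹ * w) - b (x⁻¹ * y)) = _
    have e1 : x⁻¹ * w = x⁻¹ * y * (y⁻¹ * w) := by rw [mul_assoc, mul_inv_cancel_left]
    rw [e1, hb]
    abel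
  have hz : z = ((homogeneousCochains (trivCoeff G Λ)).toCycles 1 2).hom σ := by
    apply cocyclesTwo_ext (trivCoeff G Λ)
    have h := congrArg (fun ψ => ψ.hom σ) ((homogeneousCochains (trivCoeff G Λ)).toCycles_i 1 2)
    simp only [TopModuleCat.hom_comp, ContinuousLinearMap.coe_comp, Function.comp_apply] at h
    rw [h, hd]
  rw [hz]
  have h := congrArg (fun ψ => ψ.hom σ)
    ((homogeneousCochains (trivCoeff G Λ)).toCycles_comp_homologyπ 1 2)
  simp only [TopModuleCat.hom_comp, ContinuousLinearMap.coe_comp, Function.comp_apply] at h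
  exact h

/-- Conversely, a `2`-cocycle of class `0` has an inhomogeneous cocycle that is an inhomogeneous coboundary
of a continuous function. [cite: SerreGaloisCohomology1997, I §2.3] -/
theorem exists_oneCochain_of_π_two_eq_zero (z : (homogeneousCochains (trivCoeff G Λ)).cycles 2)
    (hz : ((homogeneousCochains (trivCoeff G Λ)).homologyπ 2).hom z = 0) :
    ∃ b : C(G, Λ), ∀ g h, (((homogeneousCochains (trivCoeff G Λ)).iCycles 2).hom z).1 1 g (g * h) =
      b g + b h - b (g * h) := by
  obtain ⟨σ, hσ⟩ := exists_toCycles_eq_of_π_two_eq_zero.{0, v, v} (trivCoeff G Λ) z hz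
  have hd : ((homogeneousCochains (trivCoeff G Λ)).d 1 2).hom σ =
      ((homogeneousCochains (trivCoeff G Λ)).iCycles 2).hom z := by
    have h := congrArg (fun ψ => ψ.hom σ) ((homogeneousCochains (trivCoeff G Λ)).toCycles_i 1 2)
    simp only [TopModuleCat.hom_comp, ContinuousLinearMap.coe_comp, Function.comp_apply] at h
    rw [hσ] at h
    exact h.symm
  refine ⟨σ.1 1, fun g h => ?_⟩
  have key : σ.1 g (g * h) - (σ.1 1 (g * h) - σ.1 1 g) =
      (((homogeneousCochains (trivCoeff G Λ)).iCycles 2).hom z).1 1 g (g * h) := by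
    rw [← d_oneCochain_apply, hd]
  rw [oneCochain_apply_eq (Λ := Λ) σ g (g * h), inv_mul_cancel_left] at key
  rw [← key]
  abel

/-- **Inhomogeneous criterion for `H²(G, Λ) = 0`** (`G` locally compact): if every JOINTLY CONTINUOUS
NORMALIZED inhomogeneous `2`-cocycle `c : G × G → Λ` (`c(g,h) + c(gh,l) = c(g,hl) + c(h,l)`, `c(1,1) = 0`)
is the coboundary `c(g,h) = β(gh) − β(g) − β(h)` of a continuous `β : G → Λ`, then every class of
Mathlib's continuous `H²(G, Λ)` (trivial coefficients) vanishes. [cite: SerreGaloisCohomology1997, I §2.3] -/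
theorem π_two_eq_zero_of_forall_inhomogeneous [LocallyCompactSpace G]
    (H : ∀ c : G → G → Λ, Continuous (fun p : G × G => c p.1 p.2) →
      (∀ g h l, c g h + c (g * h) l = c g (h * l) + c h l) → c 1 1 = 0 →
        ∃ β : C(G, Λ), ∀ g h, c g h = β (g * h) - β g - β h)
    (z : (homogeneousCochains (trivCoeff G Λ)).cycles 2) :
    ((homogeneousCochains (trivCoeff G Λ)).homologyπ 2).hom z = 0 := by
  have hF := d_iCycles_two z
  -- name the cochain of `z` with its cochain type, and the constant `K = F(1,1,1)`
  obtain ⟨F, hFz⟩ : ∃ F : (homogeneousCochains (trivCoeff G Λ)).X 2,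
      ((homogeneousCochains (trivCoeff G Λ)).iCycles 2).hom z = F := ⟨_, rfl⟩
  rw [hFz] at hF
  obtain ⟨K, hK⟩ : ∃ K : Λ, F.1 1 1 1 = K := ⟨_, rfl⟩
  obtain ⟨β, hβ⟩ := H (fun g h => F.1 1 g (g * h) - K)
    ((continuous_twoCochain_inhomogeneous F).sub continuous_const)
    (fun g h l => by
      have h3 := twoCocycle_inhomogeneous F hF g h l
      rw [mul_assoc] at h3 ⊢
      rw [sub_add_sub_comm, sub_add_sub_comm, h3])
    (by rw [mul_one, hK, sub_self])
  let b : C(G, Λ) := ContinuousMap.const G K - β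
  refine π_two_eq_zero_of_exists_oneCochain z b fun g h => ?_
  have h2 := hβ g h
  rw [hFz]
  change F.1 1 g (g * h) = (K - β g) + (K - β h) - (K - β (g * h))
  rw [sub_eq_iff_eq_add] at h2
  rw [h2]
  abel

end Inhomogeneous

end ContinuousCohomology
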